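import Summits.HubbardSuperconductivity.HubbardSuperconductivity.Theses.ThermalWedge
import Literature.MathematicalPhysics.QuantumLattice.ApproximatingHamiltonianProofs
import Literature.MathematicalPhysics.QuantumLattice.DWaveSourceProofs

/-!
# Route `ThermalWedge`, crux `TwSourcedInertness` (item `stmt-HubbardSuperconductivity-1696`):
# a priori bounds and the reduction to the free gas plus a small-source window

Support file (`--supports stmt-HubbardSuperconductivity-1696`); no definition is introduced, the
sourced pressure `p̃_L(β,μ,U,h) = log Re Z_β(dWaveSourceTorus L U μ h) / (βL²)` is spelled out.

The crux asks `p̃_L(β,μ,U,h) − p̃_L(β,μ,U,0) ≤ C(1+log β)h²` for all real `h`, eventually in `L`,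
for `0 < U ≤ U₀`, `1 ≤ β ≤ e^{a/U}`, `μ` in a compact of `(−4,0)`. Proved here (all `L`, all
parameters, sorry-free):

* `norm_dWavePairSource_le` — `‖Δ_d + Δ_dᴴ‖ ≤ 8√2·L²` (`Δ_d = pairField dWaveFormFactor L`);
* `abs_sourcedPressure_sub_le` — the sourced pressure is `8√2`-Lipschitz in the source `h`
  (Bogoliubov/Peierls convexity ⇒ `|log Z(H₁) − log Z(H₂)| ≤ β‖H₁ − H₂‖`, tree lemma
  `abs_log_partitionFn_sub_log_partitionFn_le`); hence `sourcedGain_le_of_large_source`: the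
  crux's inequality is AUTOMATIC for `|h| ≥ 8√2/(C(1+log β))`;
* `norm_hubbardTorusWith_sub_le` — `‖H_L(U,μ) − H_L(0,μ)‖ ≤ U·L²` (`Σ_x n_{x↑}n_{x↓}` has norm
  `≤ L²`), hence `abs_sourcedPressure_interacting_sub_free_le`: `|p̃_L(β,μ,U,h) − p̃_L(β,μ,0,h)| ≤ U`
  and `sourcedGain_le_free_add`: `G_U(h) ≤ G_0(h) + 2U` for the gains `G_U(h) = p̃(U,h) − p̃(U,0)`;
* **`twSourcedInertness_of_free_of_window`** — the crux follows from
  (F) the FREE sourced bound `p̃_L(β,μ,0,s) − p̃_L(β,μ,0,0) ≤ C₀(1+log β)s²` (all real `s`,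
  eventually in `L`, `β ≥ 1`, `μ` in the compact; an identity-level BdG computation of the `U = 0`
  `d`-wave-sourced torus — not yet in the tree), and
  (W) the same inequality as the crux but ONLY in the window `h²(1+log β) ≤ κU` (the interacting
  `d`-wave pair susceptibility; this is the irreducible constructive content, Benfatto–Giuliani–
  Mastropietro 2006 Thm 1.1 with a Nambu source at general filling).
  Outside the window, `G_U(h) ≤ G_0(h) + 2U < (C₀ + 2/κ)(1+log β)h²`.

So every source with `h² ≳ U/(1+log β)` is settled by the free gas; the content of the crux is the
window `|h| ≲ √(κU/(1+log β))` (at `β = e^{a/U}`: `|h| ≲ U√(κ/a)`).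

Sources: Bogoliubov/Peierls convexity and Lipschitz continuity of `log Tr e^{−βH}` (folklore;
B. Simon, *The Statistical Mechanics of Lattice Gases* I (1993) §II; tree
`ApproximatingHamiltonianProofs`); D. J. Scalapino, Phys. Rep. 250 (1995) 329 §2 (pair field);
G. Benfatto, A. Giuliani, V. Mastropietro, AHP 7 (2006) 809, Thm 1.1 and Remark 2 (the regime).
The constant `8√2` and the large-`h` remark reproduce §B of the standing disprover's work file
`Cruxes/TwSourcedInertness/Disproof.lean` (refuter-cdisprove, 2026-08-15), re-derived here because
crux work files are not importable.
-/

noncomputable section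

namespace Summit.HubbardSuperconductivity.HubbardSuperconductivity.Theorems

open scoped Matrix.Norms.L2Operator ComplexOrder
open Matrix Finset Literature.MathematicalPhysics.QuantumLattice Literature.Probability.LatticeModels
open Summit.HubbardSuperconductivity.HubbardSuperconductivity.Theses.ThermalWedge

/-! ### Norm of the `d`-wave pair source -/

section Source

variable (L : ℕ) [NeZero L]

/-- `|d(e)| ≤ 1` for the `d_{x²−y²}` form factor. [folklore] -/
theorem abs_dWaveFormFactor_le_one (e : Site 2) : |dWaveFormFactor e| ≤ 1 := by
  unfold dWaveFormFactor
  split_ifs <;> norm_num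

/-- `Σ_{e ∈ {0,±e₁,±e₂}} |d(e)/√2| ≤ 2√2` (the `e = 0` term vanishes, the four steps contribute
`≤ 1/√2` each). [folklore] -/
theorem sum_abs_dWaveFormFactor_div_sqrt_two_le :
    ∑ e ∈ insert (0 : Site 2) unitSteps, |dWaveFormFactor e / Real.sqrt 2| ≤ 2 * Real.sqrt 2 := by
  have h0 : (0 : Site 2) ∉ unitSteps := by
    simp only [unitSteps, Finset.mem_insert, Finset.mem_singleton]; decide
  have hsqrt : (0 : ℝ) < Real.sqrt 2 := by positivity
  have hsq : Real.sqrt 2 * Real.sqrt 2 = 2 := Real.mul_self_sqrt zero_le_two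
  rw [Finset.sum_insert h0, dWaveFormFactor_zero, zero_div, abs_zero, zero_add]
  have hcard : (unitSteps.card : ℝ) ≤ 4 := by
    have : unitSteps.card ≤ 4 := by
      unfold unitSteps
      refine (Finset.card_insert_le _ _).trans ?_
      refine (Nat.succ_le_succ (Finset.card_insert_le _ _)).trans ?_
      refine (Nat.succ_le_succ (Nat.succ_le_succ (Finset.card_insert_le _ _))).trans ?_
      rw [Finset.card_singleton]
    exact_mod_cast this
  calc ∑ e ∈ unitSteps, |dWaveFormFactor e / Real.sqrt 2|
      ≤ ∑ _e ∈ unitSteps, (1 / Real.sqrt 2 : ℝ) := by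
        refine Finset.sum_le_sum fun e _ => ?_
        rw [abs_div, abs_of_pos hsqrt]
        exact div_le_div_of_nonneg_right (abs_dWaveFormFactor_le_one e) hsqrt.le
    _ = unitSteps.card * (1 / Real.sqrt 2) := by rw [Finset.sum_const, nsmul_eq_mul]
    _ ≤ 4 * (1 / Real.sqrt 2) := by gcongr
    _ = 2 * Real.sqrt 2 := by
        field_simp
        nlinarith [hsq]

/-- `‖Δ_d‖ ≤ 4√2·L²` for the `d`-wave pair field of the `L × L` torus. [cite: Scalapino1995, §2] -/
theorem norm_pairField_dWave_le :
    ‖pairField dWaveFormFactor L‖ ≤ 4 * Real.sqrt 2 * (L : ℝ) ^ 2 := by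
  refine (norm_pairField_le dWaveFormFactor L).trans ?_
  have hL : (0 : ℝ) ≤ (L : ℝ) ^ 2 := by positivity
  have h := sum_abs_dWaveFormFactor_div_sqrt_two_le
  nlinarith

/-- **`‖Δ_d + Δ_dᴴ‖ ≤ 8√2·L²`** (the Hermitian `d`-wave pair source of `dWaveSourceTorus`). [folklore] -/
theorem norm_dWavePairSource_le :
    ‖pairField dWaveFormFactor L + (pairField dWaveFormFactor L)ᴴ‖ ≤ 8 * Real.sqrt 2 * (L : ℝ) ^ 2 := by
  refine (norm_add_le _ _).trans ?_
  rw [Matrix.l2_opNorm_conjTranspose]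
  have h := norm_pairField_dWave_le L
  linarith

/-! ### Lipschitz continuity of the sourced pressure in the source -/

/-- The sourced torus Hamiltonian is Hermitian (unconditional form). [folklore] -/
theorem isHermitian_dWaveSourceTorus (U μ h : ℝ) : (dWaveSourceTorus L U μ h).IsHermitian :=
  dWaveSourceTorus_isHermitian L (isHermitian_hubbardTorusWith L 1 U μ) h

/-- Two sourced Hamiltonians differ by `(h' − h)·(Δ_d + Δ_dᴴ)`. [folklore] -/
theorem dWaveSourceTorus_sub_dWaveSourceTorus (U μ h h' : ℝ) :
    dWaveSourceTorus L U μ h - dWaveSourceTorus L U μ h' =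
      ((h' - h : ℝ) : ℂ) • (pairField dWaveFormFactor L + (pairField dWaveFormFactor L)ᴴ) := by
  simp only [dWaveSourceTorus]
  rw [Complex.ofReal_sub, sub_smul]
  abel

/-- **The sourced pressure is `8√2`-Lipschitz in the source**: for all `L, U, μ`, `β > 0`, `h, h'`,
`|p̃_L(β,μ,U,h) − p̃_L(β,μ,U,h')| ≤ 8√2·|h − h'|`. [folklore] -/
theorem abs_sourcedPressure_sub_le (U μ : ℝ) {β : ℝ} (hβ : 0 < β) (h h' : ℝ) :
    |Real.log (partitionFn β (dWaveSourceTorus L U μ h)).re / (β * (L : ℝ) ^ 2) -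
        Real.log (partitionFn β (dWaveSourceTorus L U μ h')).re / (β * (L : ℝ) ^ 2)| ≤
      8 * Real.sqrt 2 * |h - h'| := by
  have hL := cast_sq_pos_of_neZero L
  have hβL : 0 < β * (L : ℝ) ^ 2 := mul_pos hβ hL
  rw [← sub_div, abs_div, abs_of_pos hβL, div_le_iff₀ hβL]
  have key := abs_log_partitionFn_sub_log_partitionFn_le (isHermitian_dWaveSourceTorus L U μ h)
    (isHermitian_dWaveSourceTorus L U μ h') hβ.le
  refine key.trans ?_
  rw [dWaveSourceTorus_sub_dWaveSourceTorus, norm_smul, Complex.norm_real, Real.norm_eq_abs,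
    abs_sub_comm]
  have hn := norm_dWavePairSource_le L
  calc β * (|h - h'| * ‖pairField dWaveFormFactor L + (pairField dWaveFormFactor L)ᴴ‖)
      ≤ β * (|h - h'| * (8 * Real.sqrt 2 * (L : ℝ) ^ 2)) := by gcongr
    _ = 8 * Real.sqrt 2 * |h - h'| * (β * (L : ℝ) ^ 2) := by ring

/-- The sourced pressure GAIN is at most linear: `p̃_L(h) − p̃_L(0) ≤ 8√2·|h|`. [folklore] -/
theorem sourcedGain_le_linear (U μ : ℝ) {β : ℝ} (hβ : 0 < β) (h : ℝ) :
    Real.log (partitionFn β (dWaveSourceTorus L U μ h)).re / (β * (L : ℝ) ^ 2) -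
        Real.log (partitionFn β (dWaveSourceTorus L U μ 0)).re / (β * (L : ℝ) ^ 2) ≤
      8 * Real.sqrt 2 * |h| := by
  have := abs_sourcedPressure_sub_le L U μ hβ h 0
  rw [sub_zero] at this
  exact (le_abs_self _).trans this

/-- **Large sources are automatic**: if `8√2 ≤ C(1+log β)|h|` then the crux's inequality
`p̃_L(h) − p̃_L(0) ≤ C(1+log β)h²` holds (every `L, U, μ`, `β > 0`). [folklore] -/
theorem sourcedGain_le_of_large_source (U μ : ℝ) {β C h : ℝ} (hβ : 0 < β)
    (hh : 8 * Real.sqrt 2 ≤ C * (1 + Real.log β) * |h|) :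
    Real.log (partitionFn β (dWaveSourceTorus L U μ h)).re / (β * (L : ℝ) ^ 2) -
        Real.log (partitionFn β (dWaveSourceTorus L U μ 0)).re / (β * (L : ℝ) ^ 2) ≤
      C * (1 + Real.log β) * h ^ 2 := by
  refine (sourcedGain_le_linear L U μ hβ h).trans ?_
  calc 8 * Real.sqrt 2 * |h| ≤ C * (1 + Real.log β) * |h| * |h| :=
        mul_le_mul_of_nonneg_right hh (abs_nonneg h)
    _ = C * (1 + Real.log β) * h ^ 2 := by rw [mul_assoc, ← sq, sq_abs]

/-! ### Comparison with the free (`U = 0`) sourced gas -/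

/-- `‖Σ_x n_{x↑} n_{x↓}‖ ≤ |Λ|` on any finite lattice (`‖n_{xσ}‖ ≤ ‖c†‖‖c‖ ≤ 1`). [folklore] -/
theorem norm_sum_numberOp_mul_numberOp_le {Λ : Type*} [LinearOrder Λ] [Fintype Λ] :
    ‖(∑ x : Λ, numberOp x 0 * numberOp x 1 : Matrix (Finset (Orb Λ)) (Finset (Orb Λ)) ℂ)‖ ≤
      Fintype.card Λ := by
  have hn : ∀ (x : Λ) (σ : Fin 2),
      ‖(numberOp x σ : Matrix (Finset (Orb Λ)) (Finset (Orb Λ)) ℂ)‖ ≤ 1 := fun x σ => by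
    rw [numberOp]
    exact (norm_mul_le _ _).trans
      (mul_le_one₀ (norm_creation_le_one _) (norm_nonneg _) (norm_annihilation_le_one _))
  refine (norm_sum_le _ _).trans ?_
  calc ∑ x : Λ, ‖(numberOp x 0 * numberOp x 1 : Matrix (Finset (Orb Λ)) (Finset (Orb Λ)) ℂ)‖
      ≤ ∑ _x : Λ, (1 : ℝ) := Finset.sum_le_sum fun x _ =>
        (norm_mul_le _ _).trans (mul_le_one₀ (hn x 0) (norm_nonneg _) (hn x 1))
    _ = Fintype.card Λ := by rw [Finset.sum_const, Finset.card_univ, nsmul_eq_mul, mul_one]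

omit [NeZero L] in
/-- `|Λ_L| = L²` for the fermionic torus `(ℤ/Lℤ)²`. [folklore] -/
theorem card_fermionTorus_two : Fintype.card (FermionTorus 2 L) = L ^ 2 := by
  simp [FermionTorus, Fintype.card_lex]

/-- Switching on the repulsion changes the sourced Hamiltonian by `U·Σ_x n_{x↑}n_{x↓}`. [folklore] -/
theorem dWaveSourceTorus_sub_free (U μ h : ℝ) :
    dWaveSourceTorus L U μ h - dWaveSourceTorus L 0 μ h =
      (U : ℂ) • ∑ x : FermionTorus 2 L, numberOp x 0 * numberOp x 1 := by
  simp only [dWaveSourceTorus, hubbardTorusWith, hamiltonianWith, hamiltonian, Complex.ofReal_zero,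
    zero_smul, add_zero]
  abel

/-- `‖H_L(U,μ,h) − H_L(0,μ,h)‖ ≤ |U|·L²`. [folklore] -/
theorem norm_dWaveSourceTorus_sub_free_le (U μ h : ℝ) :
    ‖dWaveSourceTorus L U μ h - dWaveSourceTorus L 0 μ h‖ ≤ |U| * (L : ℝ) ^ 2 := by
  rw [dWaveSourceTorus_sub_free, norm_smul, Complex.norm_real, Real.norm_eq_abs]
  refine mul_le_mul_of_nonneg_left ?_ (abs_nonneg U)
  have h := norm_sum_numberOp_mul_numberOp_le (Λ := FermionTorus 2 L)
  rw [card_fermionTorus_two] at h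
  exact_mod_cast h

/-- **Interacting vs free sourced pressure**: `|p̃_L(β,μ,U,h) − p̃_L(β,μ,0,h)| ≤ |U|` for all
`L, μ, h` and `β > 0`. [folklore] -/
theorem abs_sourcedPressure_interacting_sub_free_le (U μ h : ℝ) {β : ℝ} (hβ : 0 < β) :
    |Real.log (partitionFn β (dWaveSourceTorus L U μ h)).re / (β * (L : ℝ) ^ 2) -
        Real.log (partitionFn β (dWaveSourceTorus L 0 μ h)).re / (β * (L : ℝ) ^ 2)| ≤ |U| := by
  have hL := cast_sq_pos_of_neZero L
  have hβL : 0 < β * (L : ℝ) ^ 2 := mul_pos hβ hL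
  rw [← sub_div, abs_div, abs_of_pos hβL, div_le_iff₀ hβL]
  have key := abs_log_partitionFn_sub_log_partitionFn_le (isHermitian_dWaveSourceTorus L U μ h)
    (isHermitian_dWaveSourceTorus L 0 μ h) hβ.le
  refine key.trans ?_
  calc β * ‖dWaveSourceTorus L U μ h - dWaveSourceTorus L 0 μ h‖ ≤ β * (|U| * (L : ℝ) ^ 2) := by
        gcongr
        exact norm_dWaveSourceTorus_sub_free_le L U μ h
    _ = |U| * (β * (L : ℝ) ^ 2) := by ring

/-- **The interacting gain exceeds the free gain by at most `2|U|`**: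
`[p̃(U,h) − p̃(U,0)] ≤ [p̃(0,h) − p̃(0,0)] + 2|U|`. [folklore] -/
theorem sourcedGain_le_free_add (U μ h : ℝ) {β : ℝ} (hβ : 0 < β) :
    Real.log (partitionFn β (dWaveSourceTorus L U μ h)).re / (β * (L : ℝ) ^ 2) -
        Real.log (partitionFn β (dWaveSourceTorus L U μ 0)).re / (β * (L : ℝ) ^ 2) ≤
      (Real.log (partitionFn β (dWaveSourceTorus L 0 μ h)).re / (β * (L : ℝ) ^ 2) -
        Real.log (partitionFn β (dWaveSourceTorus L 0 μ 0)).re / (β * (L : ℝ) ^ 2)) + 2 * |U| := by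
  have h1 := abs_sourcedPressure_interacting_sub_free_le L U μ h hβ
  have h2 := abs_sourcedPressure_interacting_sub_free_le L U μ 0 hβ
  rw [abs_le] at h1 h2
  linarith [h1.2, h2.1]

end Source

/-! ### The reduction: free sourced bound + small-source window ⇒ the crux -/

/-- **Reduction of `TwSourcedInertness` to the free gas plus a small-source window.**
Hypothesis (F): the FREE (`U = 0`) sourced pressure gain is `≤ C₀(1+log β)s²` for every real
source `s`, eventually in `L`, for `β ≥ 1` and `μ` in the compact. Hypothesis (W): the crux's
inequality restricted to sources in the window `h²(1+log β) ≤ κU`. Then the crux holds, with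
`C' = max C (C₀ + 2/κ)`: outside the window the free bound and
`G_U(h) ≤ G_0(h) + 2U < (C₀ + 2/κ)(1+log β)h²` suffice. [folklore] -/
theorem twSourcedInertness_of_free_of_window
    (hF : ∀ μ₁ μ₂ : ℝ, -4 < μ₁ → μ₁ ≤ μ₂ → μ₂ < 0 → ∃ C₀ : ℝ, 0 < C₀ ∧
      ∀ β : ℝ, 1 ≤ β → ∀ μ ∈ Set.Icc μ₁ μ₂, ∃ L₀ : ℕ, ∀ (L : ℕ) [NeZero L], L₀ ≤ L → ∀ s : ℝ,
        Real.log (partitionFn β (dWaveSourceTorus L 0 μ s)).re / (β * (L : ℝ) ^ 2) -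
            Real.log (partitionFn β (dWaveSourceTorus L 0 μ 0)).re / (β * (L : ℝ) ^ 2) ≤
          C₀ * (1 + Real.log β) * s ^ 2)
    (hW : ∀ μ₁ μ₂ : ℝ, -4 < μ₁ → μ₁ ≤ μ₂ → μ₂ < 0 → ∃ U₀ a C κ : ℝ, 0 < U₀ ∧ 0 < a ∧ 0 < C ∧
      0 < κ ∧ ∀ U : ℝ, 0 < U → U ≤ U₀ → ∀ β : ℝ, 1 ≤ β → β ≤ Real.exp (a / U) →
        ∀ μ ∈ Set.Icc μ₁ μ₂, ∃ L₀ : ℕ, ∀ (L : ℕ) [NeZero L], L₀ ≤ L → ∀ h : ℝ,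
          h ^ 2 * (1 + Real.log β) ≤ κ * U →
          Real.log (partitionFn β (dWaveSourceTorus L U μ h)).re / (β * (L : ℝ) ^ 2) -
              Real.log (partitionFn β (dWaveSourceTorus L U μ 0)).re / (β * (L : ℝ) ^ 2) ≤
            C * (1 + Real.log β) * h ^ 2) :
    TwSourcedInertness := by
  intro μ₁ μ₂ h4 h12 h0
  obtain ⟨C₀, hC₀, hFree⟩ := hF μ₁ μ₂ h4 h12 h0
  obtain ⟨U₀, a, C, κ, hU₀, ha, hC, hκ, hWin⟩ := hW μ₁ μ₂ h4 h12 h0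
  refine ⟨U₀, a, max C (C₀ + 2 / κ), hU₀, ha, lt_max_of_lt_left hC, ?_⟩
  intro U hU hUU₀ β hβ hβa μ hμ
  obtain ⟨L₁, hL₁⟩ := hFree β hβ μ hμ
  obtain ⟨L₂, hL₂⟩ := hWin U hU hUU₀ β hβ hβa μ hμ
  refine ⟨max L₁ L₂, fun L _ hL h => ?_⟩
  have hβ0 : 0 < β := by linarith
  have hlog : 0 < 1 + Real.log β := by
    have := Real.log_nonneg hβ
    linarith
  have hh2 : 0 ≤ (1 + Real.log β) * h ^ 2 := by positivity
  by_cases hwin : h ^ 2 * (1 + Real.log β) ≤ κ * U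
  · -- inside the window: hypothesis (W)
    refine (hL₂ L (le_of_max_le_right hL) h hwin).trans ?_
    have : C * (1 + Real.log β) * h ^ 2 ≤ max C (C₀ + 2 / κ) * (1 + Real.log β) * h ^ 2 := by
      rw [mul_assoc, mul_assoc]
      exact mul_le_mul_of_nonneg_right (le_max_left _ _) hh2
    exact this
  · -- outside the window: free bound + interaction comparison
    rw [not_le] at hwin
    have hfree := hL₁ L (le_of_max_le_left hL) h
    have hcomp := sourcedGain_le_free_add L U μ h hβ0
    rw [abs_of_pos hU] at hcomp
    have hU2 : 2 * U ≤ 2 / κ * ((1 + Real.log β) * h ^ 2) := by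
      rw [div_mul_eq_mul_div, le_div_iff₀ hκ]
      nlinarith [hwin]
    calc Real.log (partitionFn β (dWaveSourceTorus L U μ h)).re / (β * (L : ℝ) ^ 2) -
          Real.log (partitionFn β (dWaveSourceTorus L U μ 0)).re / (β * (L : ℝ) ^ 2)
        ≤ C₀ * (1 + Real.log β) * h ^ 2 + 2 * U := by linarith
      _ ≤ (C₀ + 2 / κ) * (1 + Real.log β) * h ^ 2 := by nlinarith [hU2]
      _ ≤ max C (C₀ + 2 / κ) * (1 + Real.log β) * h ^ 2 := by
          rw [mul_assoc, mul_assoc]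
          exact mul_le_mul_of_nonneg_right (le_max_right _ _) hh2

end Summit.HubbardSuperconductivity.HubbardSuperconductivity.Theorems
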